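import Mathlib
import Summits.CriticalPhenomena.PercolationContinuityZ3.Theorems.PercNearOneGluingNoHeavyLowerTailStarLemma

/-!
# Crux `PercNearOneGluing.NoHeavyLowerTail` (stmt-CriticalPhenomena-4575), line `bhk-superadditivity-thinning` —
# the Star Lemma over an arbitrary finite unit set (stub `starLemma_finset`)

Lead `prover-line-stmt-CriticalPhenomena-4575-c3-0`, 2026-08-16; lands with `--supports stmt-CriticalPhenomena-4575`.

`starLemma` (file `PercNearOneGluingNoHeavyLowerTailStarLemma`) is the law-level first-hit charging
inequality with the units indexed by `Finset.range k` and priority given to larger indices.  Here the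
same inequality is stated for an arbitrary unit set `U : Finset α` carrying a rank function
`rank : α → ℕ` that is injective on `U` (priority to larger rank; the hit weight of `a` is
`q a * ∏_{a' ∈ U, rank a < rank a'} (1 - q a')`), which is the form needed to apply it to relay sets
`A : Finset (Fin n)` in percolation.

The proof is a pure transport: the rank compression `g a = #{a' ∈ U | rank a' < rank a}` is a
rank-monotone bijection from `U` onto `range #U`; with `f` its inverse on `U` we apply `starLemma'` to the
coins `q ∘ f` and the alive sets `{j < #U | f j ∈ L ω}` and rewrite every sum and product along the
bijection (`Finset.prod_nbij'`, `Finset.sum_nbij'`); the filter `{a' ∈ U | rank a < rank a'}` corresponds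
to `Finset.Ico (g a + 1) #U`.
-/

namespace Summit.CriticalPhenomena.PercolationContinuityZ3.Theorems

open Finset

open scoped BigOperators

/-- **The Star Lemma over a finite unit set** (stub `starLemma_finset` of stmt-CriticalPhenomena-4575).
Units `a ∈ U` carry independent entrance coins of weights `q a ∈ [0,1]` and an injective priority
`rank`; `(s, p)` is a finitely supported nonnegative law of the random alive set `L ω`.  If the deadness
`Σ_ω p ω 1{a ∉ L ω}` is non-decreasing along `rank` on `U`, then the bad mass
`Σ_ω p ω (∏_{a ∈ U} (1 - q a 1{a ∈ L ω}) - ∏_{a ∈ U} (1 - q a))` is at most the hit-weighted sum of the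
unreliabilities, the hit weight of `a` being `q a ∏_{a' ∈ U, rank a < rank a'} (1 - q a')`
(priority to larger rank).  Transported from `starLemma'` along the rank compression of `U`. -/
theorem starLemma_finset : ∀ {Ω α : Type*} [DecidableEq α] (s : Finset Ω) (p : Ω → ℝ), (∀ ω ∈ s, 0 ≤ p ω) → ∀ (U : Finset α) (rank : α → ℕ), Set.InjOn rank (↑U : Set α) → ∀ (L : Ω → Finset α) (q : α → ℝ), (∀ a, 0 ≤ q a) → (∀ a, q a ≤ 1) → (∀ a ∈ U, ∀ a' ∈ U, rank a ≤ rank a' → (Finset.sum s (fun ω => p ω * (if a ∈ L ω then (0 : ℝ) else 1))) ≤ (Finset.sum s (fun ω => p ω * (if a' ∈ L ω then (0 : ℝ) else 1)))) → (Finset.sum s (fun ω => p ω * ((Finset.prod U (fun a => if a ∈ L ω then (1 : ℝ) - q a else 1)) - (Finset.prod U (fun a => (1 : ℝ) - q a))))) ≤ ∑ a ∈ U, ((q a) * Finset.prod (U.filter (fun a' => rank a < rank a')) (fun a' => (1 : ℝ) - q a')) * (Finset.sum s (fun ω => p ω * (if a ∈ L ω then (0 : ℝ) else 1 - (q a) *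 (1 - (Finset.prod U (fun a' => if a' ∈ L ω then (1 : ℝ) - q a' else 1)))))) := by
  intro Ω α _ s p hp U rank hrank L q hq0 hq1 hmono
  rcases Finset.eq_empty_or_nonempty U with hU | ⟨a₀, ha₀⟩
  · subst hU
    simp
  haveI : Nonempty α := ⟨a₀⟩
  -- Step 1: the rank compression `g a = #{a' ∈ U | rank a' < rank a}`.
  obtain ⟨g, hg_ltk, hg_lt⟩ : ∃ g : α → ℕ, (∀ a ∈ U, g a < U.card) ∧
      (∀ a ∈ U, ∀ a' ∈ U, rank a < rank a' → g a < g a') := by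
    refine ⟨fun a => (U.filter (fun a' => rank a' < rank a)).card, fun a ha => ?_,
      fun a ha a' ha' h => ?_⟩
    · exact Finset.card_lt_card (Finset.filter_ssubset.2 ⟨a, ha, lt_irrefl _⟩)
    · dsimp only
      apply Finset.card_lt_card
      refine (Finset.ssubset_iff_of_subset ?_).2 ⟨a, Finset.mem_filter.2 ⟨ha, h⟩, by simp⟩
      intro x hx
      rw [Finset.mem_filter] at hx ⊢
      exact ⟨hx.1, hx.2.trans h⟩
  -- `g` reflects the rank order and is injective on `U`.
  have hg_rank : ∀ a ∈ U, ∀ a' ∈ U, g a < g a' → rank a < rank a' := by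
    intro a ha a' ha' h
    rcases lt_trichotomy (rank a) (rank a') with hlt | heq | hgt
    · exact hlt
    · exact absurd (hrank (Finset.mem_coe.2 ha) (Finset.mem_coe.2 ha') heq ▸ h) (lt_irrefl _)
    · exact absurd (h.trans (hg_lt a' ha' a ha hgt)) (lt_irrefl _)
  have hg_inj : Set.InjOn g (↑U : Set α) := by
    intro a ha a' ha' h
    have ha₁ : a ∈ U := Finset.mem_coe.1 ha
    have ha₁' : a' ∈ U := Finset.mem_coe.1 ha'
    by_contra hne
    have hne' : rank a ≠ rank a' := fun heq => hne (hrank ha ha' heq)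
    rcases Ne.lt_or_gt hne' with hlt | hlt
    · exact absurd h (hg_lt a ha₁ a' ha₁' hlt).ne
    · exact absurd h (hg_lt a' ha₁' a ha₁ hlt).ne'
  -- `g` maps `U` onto `range #U`.
  have hg_img : U.image g = Finset.range U.card := by
    apply Finset.eq_of_subset_of_card_le
    · intro j hj
      obtain ⟨a, ha, rfl⟩ := Finset.mem_image.1 hj
      exact Finset.mem_range.2 (hg_ltk a ha)
    · rw [Finset.card_range, Finset.card_image_of_injOn hg_inj]
  -- Step 2: the inverse enumeration `f` of `U` by increasing rank.
  obtain ⟨f, hfg, hf⟩ : ∃ f : ℕ → α, (∀ a ∈ U, f (g a) = a) ∧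
      (∀ j, j < U.card → f j ∈ U ∧ g (f j) = j) := by
    refine ⟨Function.invFunOn g (↑U : Set α),
      fun a ha => hg_inj.leftInvOn_invFunOn (Finset.mem_coe.2 ha), fun j hj => ?_⟩
    have hj' : j ∈ U.image g := by
      rw [hg_img]
      exact Finset.mem_range.2 hj
    obtain ⟨a, ha, hga⟩ := Finset.mem_image.1 hj'
    have h := Function.invFunOn_pos (f := g) (s := (↑U : Set α)) (b := j) ⟨a, Finset.mem_coe.2 ha, hga⟩
    exact ⟨Finset.mem_coe.1 h.1, h.2⟩
  -- `rank ∘ f` is monotone on `range #U`.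
  have hf_mono : ∀ i j, i ≤ j → j < U.card → rank (f i) ≤ rank (f j) := by
    intro i j hij hj
    have hi : i < U.card := lt_of_le_of_lt hij hj
    by_contra hlt
    rw [not_le] at hlt
    have h := hg_lt (f j) (hf j hj).1 (f i) (hf i hi).1 hlt
    rw [(hf j hj).2, (hf i hi).2] at h
    exact absurd hij (not_le.2 h)
  -- Step 3: the dictionary between the `U`-indexed and the `range #U`-indexed quantities.
  have hPi : ∀ ω, (Finset.prod U (fun a => if a ∈ L ω then (1 : ℝ) - q a else 1))
      = Finset.prod (Finset.range U.card) (fun i =>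
          if i ∈ (Finset.range U.card).filter (fun j => f j ∈ L ω) then (1 : ℝ) - q (f i) else 1) := by
    intro ω
    refine Finset.prod_nbij' g f (fun a ha => Finset.mem_range.2 (hg_ltk a ha))
      (fun i hi => (hf i (Finset.mem_range.1 hi)).1) hfg
      (fun i hi => (hf i (Finset.mem_range.1 hi)).2) ?_
    intro a ha
    simp only [Finset.mem_filter, Finset.mem_range, hg_ltk a ha, hfg a ha, true_and]
  have hAll : (Finset.prod U (fun a => (1 : ℝ) - q a))
      = Finset.prod (Finset.range U.card) (fun i => (1 : ℝ) - q (f i)) := by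
    refine Finset.prod_nbij' g f (fun a ha => Finset.mem_range.2 (hg_ltk a ha))
      (fun i hi => (hf i (Finset.mem_range.1 hi)).1) hfg
      (fun i hi => (hf i (Finset.mem_range.1 hi)).2) ?_
    intro a ha
    rw [hfg a ha]
  have hW : ∀ a ∈ U, Finset.prod (U.filter (fun a' => rank a < rank a')) (fun a' => (1 : ℝ) - q a')
      = Finset.prod (Finset.Ico (g a + 1) U.card) (fun i => (1 : ℝ) - q (f i)) := by
    intro a ha
    refine Finset.prod_nbij' g f ?_ ?_ ?_ ?_ ?_
    · intro a' ha'
      rw [Finset.mem_filter] at ha'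
      exact Finset.mem_Ico.2 ⟨Nat.succ_le_of_lt (hg_lt a ha a' ha'.1 ha'.2), hg_ltk a' ha'.1⟩
    · intro i hi
      rw [Finset.mem_Ico] at hi
      have hfi := hf i hi.2
      refine Finset.mem_filter.2 ⟨hfi.1, hg_rank a ha (f i) hfi.1 ?_⟩
      rw [hfi.2]
      exact Nat.lt_of_succ_le hi.1
    · intro a' ha'
      exact hfg a' (Finset.mem_filter.1 ha').1
    · intro i hi
      exact (hf i (Finset.mem_Ico.1 hi).2).2
    · intro a' ha'
      rw [hfg a' (Finset.mem_filter.1 ha').1]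
  -- Step 4: the Star Lemma for the compressed system.
  have key := starLemma' s p hp (fun ω => (Finset.range U.card).filter (fun j => f j ∈ L ω))
    (fun j => q (f j)) (fun j => hq0 (f j)) (fun j => hq1 (f j)) U.card (by
      intro i j hij hj
      have hi : i < U.card := lt_of_le_of_lt hij hj
      have hD := hmono (f i) (hf i hi).1 (f j) (hf j hj).1 (hf_mono i j hij hj)
      refine le_of_eq_of_le ?_ (hD.trans_eq ?_)
      · refine Finset.sum_congr rfl fun ω _ => ?_
        simp only [Finset.mem_filter, Finset.mem_range, hi, true_and]
      · refine Finset.sum_congr rfl fun ω _ => ?_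
        simp only [Finset.mem_filter, Finset.mem_range, hj, true_and])
  beta_reduce at key
  -- Step 5: transport back along the bijection.
  refine le_of_eq_of_le ?_ (key.trans_eq ?_)
  · refine Finset.sum_congr rfl fun ω _ => ?_
    rw [hPi ω, hAll]
  · symm
    refine Finset.sum_nbij' g f (fun a ha => Finset.mem_range.2 (hg_ltk a ha))
      (fun i hi => (hf i (Finset.mem_range.1 hi)).1) hfg
      (fun i hi => (hf i (Finset.mem_range.1 hi)).2) ?_
    intro a ha
    rw [hfg a ha, hW a ha]
    congr 1
    refine Finset.sum_congr rfl fun ω _ => ?_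
    rw [hPi ω]
    simp only [Finset.mem_filter, Finset.mem_range, hg_ltk a ha, hfg a ha, true_and]

end Summit.CriticalPhenomena.PercolationContinuityZ3.Theorems
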